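import Summits.QuantumFields.YangMills.Theorems.BalabanUVNodesPortS1PhiLZLogDet
import Literature.MathematicalPhysics.QuantumFieldTheory.Balaban1983to89.B10LogDet63

/-!
# NODE O port PT-A — `Φ₁ = phiLZ` THROUGH [16] (61)∕(63) AT THE RECORD: under the letters at `W_B` and `W_0` and a common form bound `⟨v, T v⟩ ≤ γ₁‖v‖²` (NODE O's (Γ₁), displayed),
# `phiLZ n B = ½∫₀^{2γ₁} [Tr(x + T(B))⁻¹ − Tr(x + T(0))⁻¹] dx + Σ_{j≥1} ((−1)ʲ∕2j)(2γ₁)⁻ʲ [Tr T(B)ʲ − Tr T(0)ʲ] − Σ_c [log|det A₁(c)(B)| − log|det A₁(c)(0)|]`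
# (`B10LogDet63.diff61_split` at `T := recordPreckLoc`, the constant `−½ log(2γ₁)·Tr I` cancelled) — the three families NODE O's walk expansion must localise: resolvent traces, power traces, and
# the single-coarse-bond δ-Jacobian terms (already local, `…PortS1JacobianLocal`)

Cell `ym-nodeO-ideate`, porter seat `ymgap-nodeO-port-PTA-1` (gen 4); `--supports stmt-QuantumFields-27930` (helper; second algebraic step of the registered stub `stub_LZ : ∀ F, PortRecordLZHalf F`, LZ-SPEC-v1
(R-a)(R-b) at the names).  [I] = [Balaban1987RG1], [16] = [Balaban1985UV3].
HONEST FRAMING.  Operator calculus of [16] (63) (tree, generic) instantiated at the record's names under DISPLAYED letters (invertible `b₀`-blocks, positivity, form bound); NOTHING of Bałaban's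
estimates asserted, ported or discharged; the walk representation ∕ (23) bounds ∕ analyticity are NOT here; `stub_LZ` NOT proved; 27930 OPEN; K0⁷∕K-Ax OPEN; NODE O 0∕1; COUNT 8∕28 · K 1∕4
UNMOVED; finite `𝕋⁴_{L^K}` at fixed ε — NOT continuum ∕ OS ∕ Clay; **the Yang–Mills mass gap is NOT proved by any of this.**  No `sorry`, no `def`, no `instance`; standard axioms.
-/

noncomputable section

open scoped BigOperators Matrix.Norms.L2Operator Topology

namespace Summit.QuantumFields.YangMills.Theorems.BalabanUVNodesPortS1

open Summit.QuantumFields.YangMills.Theorems.K0RecordFormatNames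
open Literature.MathematicalPhysics.QuantumFieldTheory.Balaban1983to89
open Literature.MathematicalPhysics.QuantumFieldTheory.Balaban1983to89.Node00
open Literature.MathematicalPhysics.QuantumFieldTheory.Balaban1983to89.T4Continuum (T4Family)
open _root_.Matrix

variable (F : T4Family)

open Classical in
/-- ★★ **`Φ₁` THROUGH (61)∕(63)**: under the letters at `W_B` and at `W_0` (invertible `b₀`-blocks, positive definite preconditioned matrices `T(·) = recordPreckLoc …`) and a COMMON form bound
`⟨v, T(·) v⟩ ≤ γ₁ ⟨v, v⟩` (`γ₁ > 0`; NODE O's (Γ₁)),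
`phiLZ n B = ½∫₀^{2γ₁} [Tr(x + T(B))⁻¹ − Tr(x + T(0))⁻¹] + Σ' j ((−1)^{j+1}∕(2(j+1)))(2γ₁)^{−(j+1)} [Tr T(B)^{j+1} − Tr T(0)^{j+1}] − Σ_c [log|det A₁(c)(B)| − log|det A₁(c)(0)|]`.
[cite: Balaban1985UV3, (61)–(63) pp.271–272; Balaban1987RG1, (2.12) p.268, (1.4) p.260] -/
theorem phiLZ_eq_resolvent (Mc : ℕ) (a₀ ε₂₉ : ℝ) (k n : ℕ) (B : recordW F a₀ ε₂₉ k (recordK₀ F Mc k + n))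
    (hA : RecordB0BlockInvertible F k (recordK₀ F Mc k + n) (portVkAx F a₀ ε₂₉ k (recordK₀ F Mc k + n) B))
    (hA₀ : letI θ := thetaFill F a₀ ε₂₉; letI := θ.instVβ₁; letI := θ.instVβ₂;
      RecordB0BlockInvertible F k (recordK₀ F Mc k + n) (portVkAx F a₀ ε₂₉ k (recordK₀ F Mc k + n) 0))
    (hP : (recordPreckLoc F k (recordK₀ F Mc k + n) (thetaFill F a₀ ε₂₉).εbg (portVkAx F a₀ ε₂₉ k (recordK₀ F Mc k + n) B)
      (hopLinGraph F k (recordK₀ F Mc k + n) (portVkAx F a₀ ε₂₉ k (recordK₀ F Mc k + n) B))).PosDef)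
    (hP₀ : letI θ := thetaFill F a₀ ε₂₉; letI := θ.instVβ₁; letI := θ.instVβ₂;
      (recordPreckLoc F k (recordK₀ F Mc k + n) (thetaFill F a₀ ε₂₉).εbg (portVkAx F a₀ ε₂₉ k (recordK₀ F Mc k + n) 0)
        (hopLinGraph F k (recordK₀ F Mc k + n) (portVkAx F a₀ ε₂₉ k (recordK₀ F Mc k + n) 0))).PosDef)
    {γ₁ : ℝ} (hγ₁ : 0 < γ₁)
    (hγ : ∀ v : NonB0Idx F k (recordK₀ F Mc k + n) → ℝ,
      v ⬝ᵥ (recordPreckLoc F k (recordK₀ F Mc k + n) (thetaFill F a₀ ε₂₉).εbg (portVkAx F a₀ ε₂₉ k (recordK₀ F Mc k + n) B)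
        (hopLinGraph F k (recordK₀ F Mc k + n) (portVkAx F a₀ ε₂₉ k (recordK₀ F Mc k + n) B)) *ᵥ v) ≤ γ₁ * (v ⬝ᵥ v))
    (hγ₀ : letI θ := thetaFill F a₀ ε₂₉; letI := θ.instVβ₁; letI := θ.instVβ₂;
      ∀ v : NonB0Idx F k (recordK₀ F Mc k + n) → ℝ,
        v ⬝ᵥ (recordPreckLoc F k (recordK₀ F Mc k + n) (thetaFill F a₀ ε₂₉).εbg (portVkAx F a₀ ε₂₉ k (recordK₀ F Mc k + n) 0)
          (hopLinGraph F k (recordK₀ F Mc k + n) (portVkAx F a₀ ε₂₉ k (recordK₀ F Mc k + n) 0)) *ᵥ v) ≤ γ₁ * (v ⬝ᵥ v)) :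
    letI θ := thetaFill F a₀ ε₂₉; letI := θ.instVβ₁; letI := θ.instVβ₂;
    letI T₁ := recordPreckLoc F k (recordK₀ F Mc k + n) (thetaFill F a₀ ε₂₉).εbg (portVkAx F a₀ ε₂₉ k (recordK₀ F Mc k + n) B)
      (hopLinGraph F k (recordK₀ F Mc k + n) (portVkAx F a₀ ε₂₉ k (recordK₀ F Mc k + n) B));
    letI T₀ := recordPreckLoc F k (recordK₀ F Mc k + n) (thetaFill F a₀ ε₂₉).εbg (portVkAx F a₀ ε₂₉ k (recordK₀ F Mc k + n) 0)
      (hopLinGraph F k (recordK₀ F Mc k + n) (portVkAx F a₀ ε₂₉ k (recordK₀ F Mc k + n) 0));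
    phiLZ F Mc a₀ ε₂₉ k n B =
      (((1 / 2 : ℝ) * (∫ x in (0 : ℝ)..(2 * γ₁),
            (Matrix.trace ((x • (1 : Matrix (NonB0Idx F k (recordK₀ F Mc k + n)) (NonB0Idx F k (recordK₀ F Mc k + n)) ℝ) + T₁)⁻¹)
              - Matrix.trace ((x • (1 : Matrix (NonB0Idx F k (recordK₀ F Mc k + n)) (NonB0Idx F k (recordK₀ F Mc k + n)) ℝ) + T₀)⁻¹)))
        + (∑' j : ℕ, (-1) ^ (j + 1) / (2 * ((j : ℝ) + 1)) * ((2 * γ₁) ^ (j + 1))⁻¹ * (Matrix.trace (T₁ ^ (j + 1)) - Matrix.trace (T₀ ^ (j + 1))))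
        - ∑ c : PBond (F.P (recordK₀ F Mc k + n)) (k + 1),
            (Real.log |(Matrix.of fun j j' : Fin 3 => recordLQtB0 F k (recordK₀ F Mc k + n) (portVkAx F a₀ ε₂₉ k (recordK₀ F Mc k + n) B) (c, j) (c, j')).det|
              - Real.log |(Matrix.of fun j j' : Fin 3 => recordLQtB0 F k (recordK₀ F Mc k + n) (portVkAx F a₀ ε₂₉ k (recordK₀ F Mc k + n) 0) (c, j) (c, j')).det|) : ℝ) : ℂ) := by
  have h := phiLZ_eq_logDet_sum F Mc a₀ ε₂₉ k n B hA hA₀ hP hP₀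
  have h61 := B10LogDet63.diff61_split hP₀ hP hγ₁ (B13Sqrt27.eigenvalues_le_of_form_le hP₀.1 hγ₀) (B13Sqrt27.eigenvalues_le_of_form_le hP.1 hγ)
  have hrw : -(1 / 2 : ℝ) * (Real.log (recordPreckLoc F k (recordK₀ F Mc k + n) (thetaFill F a₀ ε₂₉).εbg (portVkAx F a₀ ε₂₉ k (recordK₀ F Mc k + n) B)
        (hopLinGraph F k (recordK₀ F Mc k + n) (portVkAx F a₀ ε₂₉ k (recordK₀ F Mc k + n) B))).det
      - Real.log (letI θ := thetaFill F a₀ ε₂₉; letI := θ.instVβ₁; letI := θ.instVβ₂;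
          recordPreckLoc F k (recordK₀ F Mc k + n) (thetaFill F a₀ ε₂₉).εbg (portVkAx F a₀ ε₂₉ k (recordK₀ F Mc k + n) 0)
            (hopLinGraph F k (recordK₀ F Mc k + n) (portVkAx F a₀ ε₂₉ k (recordK₀ F Mc k + n) 0))).det)
      = -(1 / 2 : ℝ) * Real.log (recordPreckLoc F k (recordK₀ F Mc k + n) (thetaFill F a₀ ε₂₉).εbg (portVkAx F a₀ ε₂₉ k (recordK₀ F Mc k + n) B)
          (hopLinGraph F k (recordK₀ F Mc k + n) (portVkAx F a₀ ε₂₉ k (recordK₀ F Mc k + n) B))).det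
        - (-(1 / 2 : ℝ) * Real.log (letI θ := thetaFill F a₀ ε₂₉; letI := θ.instVβ₁; letI := θ.instVβ₂;
          recordPreckLoc F k (recordK₀ F Mc k + n) (thetaFill F a₀ ε₂₉).εbg (portVkAx F a₀ ε₂₉ k (recordK₀ F Mc k + n) 0)
            (hopLinGraph F k (recordK₀ F Mc k + n) (portVkAx F a₀ ε₂₉ k (recordK₀ F Mc k + n) 0))).det) := by
    ring
  rw [hrw, h61] at h
  exact h

end Summit.QuantumFields.YangMills.Theorems.BalabanUVNodesPortS1

end
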